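import Summits.CriticalPhenomena.PercolationContinuityZ3.Theorems.PercNearOneGluingNoHeavyLowerTailLonelyRelay
import HarnessLib

/-!
# `NoHeavyLowerTail` (stmt-CriticalPhenomena-4575) — the cumulative isolation lemma at the extreme levels

The registered stub `stub_cumulativeIsolation` (CIL) reads, for `π(v) = C(v) ∩ A` and `N = |π(o)|`:
for every level `j`, SOME relay `a ∈ A` has `P(1 ≤ N ≤ j) ≤ P(|π(a)| ≤ j)` (`A ≠ ∅`, `o ∉ A`); it closes
the crux (`Theorems.noHeavyLowerTail_of_stub_cumulativeIsolation`).  This file proves the levels that need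
no new correlation inequality:

* `cumulativeIsolation_level_one` — `j = 1`: `{1 ≤ N ≤ 1} = {N = 1}` and the landed lonely-relay lemma
  `lonelyRelay` (Kozma–Nitzan Lemma 2) with `t := max_a P(a ↮ A ∖ a)`, the maximum being attained at some
  relay `a`, for which `{a ↮ A ∖ a} = {|π(a)| ≤ 1}`.
* `cumulativeIsolation_level_ge` — `j + 1 ≥ |A|`: pointwise, `1 ≤ N ≤ j` forces `o`'s block to hold a relay
  and (if `j < |A|`) to miss one, so no relay block is all of `A` and `|π(a)| ≤ |A| − 1 ≤ j` for EVERY `a`.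
* `cumulativeIsolation_card_le_three` — hence CIL at every level whenever `|A| ≤ 3`
  (`|A| = 3`: level 1 is the lonely relay lemma, levels `≥ 2` are extreme).

The first level needing more is `j = 2` at `|A| = 4` (paper proof via Kozma–Nitzan Lemma 1(ii) + Lemma 2,
crux evidence `CIL.md`); the first open one is `|A| = 5`, `j ∈ {2, 3}`.
-/

noncomputable section

namespace Summit.CriticalPhenomena.PercolationContinuityZ3.Theorems

open MeasureTheory Set Literature.Probability.LatticeModels Literature.Probability.Percolation
open scoped Classical BigOperators

/-- For a relay `a ∈ A`: `a` is isolated from `A ∖ a` iff its relay block `{x ∈ A : a ↔ x}` has at most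
one element (namely `a` itself). [folklore] -/
theorem isolated_iff_filter_card_le_one {n : ℕ} (A : Finset (Fin n)) {a : Fin n} (ha : a ∈ A)
    (ω : BondConfig (Fin n)) :
    (∀ t ∈ A.erase a, ω ∉ (openConn a t : Set (BondConfig (Fin n)))) ↔
      (A.filter fun x => ω ∈ (openConn a x : Set (BondConfig (Fin n)))).card ≤ 1 := by
  have haa : ω ∈ (openConn a a : Set (BondConfig (Fin n))) := SimpleGraph.Reachable.refl a
  constructor
  · intro h
    rw [Finset.card_le_one]
    intro x hx y hy
    rw [Finset.mem_filter] at hx hy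
    have hx' : x = a := by
      by_contra hne
      exact h x (Finset.mem_erase.2 ⟨hne, hx.1⟩) hx.2
    have hy' : y = a := by
      by_contra hne
      exact h y (Finset.mem_erase.2 ⟨hne, hy.1⟩) hy.2
    rw [hx', hy']
  · intro h t ht hat
    obtain ⟨hne, htA⟩ := Finset.mem_erase.1 ht
    rw [Finset.card_le_one] at h
    exact hne (h t (Finset.mem_filter.2 ⟨htA, hat⟩) a (Finset.mem_filter.2 ⟨ha, haa⟩))

/-- **CIL at level 1** = the lonely relay lemma in maximum form: for nonempty `A` some relay `a ∈ A` has
`P(1 ≤ N ≤ 1) ≤ P(|π(a)| ≤ 1)`. [cite: KozmaNitzan2024, Lemma 2 (p. 6) — via Theorems.lonelyRelay] -/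
theorem cumulativeIsolation_level_one {n : ℕ} (w : Sym2 (Fin n) → unitInterval) (A : Finset (Fin n))
    (o : Fin n) (hA : A.Nonempty) :
    ∃ a ∈ A, (prodBernoulli w).real {ω : BondConfig (Fin n) |
        1 ≤ (A.filter fun x => ω ∈ openConn o x).card ∧
          (A.filter fun x => ω ∈ openConn o x).card ≤ 1} ≤
      (prodBernoulli w).real {ω : BondConfig (Fin n) |
        (A.filter fun x => ω ∈ openConn a x).card ≤ 1} := by
  -- the relay with the largest isolation probability
  obtain ⟨a, ha, hmax⟩ := Finset.exists_max_image A
    (fun a => (prodBernoulli w).real {ω : BondConfig (Fin n) | ∀ t ∈ A.erase a, ω ∉ openConn a t}) hA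
  refine ⟨a, ha, ?_⟩
  have hev : {ω : BondConfig (Fin n) |
      1 ≤ (A.filter fun x => ω ∈ openConn o x).card ∧ (A.filter fun x => ω ∈ openConn o x).card ≤ 1} =
      {ω : Set (Sym2 (Fin n)) | (A.filter fun x => ω ∈ openConn o x).card = 1} := by
    ext ω; simp only [mem_setOf_eq]; omega
  have hiso : {ω : BondConfig (Fin n) | (A.filter fun x => ω ∈ openConn a x).card ≤ 1} =
      {ω : BondConfig (Fin n) | ∀ t ∈ A.erase a, ω ∉ openConn a t} := by
    ext ω; simp only [mem_setOf_eq]; exact (isolated_iff_filter_card_le_one A ha ω).symm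
  rw [hev, hiso]
  exact lonelyRelay n w A o _ measureReal_nonneg fun a' ha' => hmax a' ha'

/-- **CIL at the extreme levels `j + 1 ≥ |A|`**, pointwise: if `1 ≤ N ≤ j` then no relay block is all of `A`
(the block of `o` holds a relay and, when `j < |A|`, misses one), so `|π(a)| ≤ j` for every vertex `a`. [folklore] -/
theorem cumulativeIsolation_level_ge {n : ℕ} (w : Sym2 (Fin n) → unitInterval) (A : Finset (Fin n))
    (o a : Fin n) (j : ℕ) (hj : A.card ≤ j + 1) :
    (prodBernoulli w).real {ω : BondConfig (Fin n) |
        1 ≤ (A.filter fun x => ω ∈ openConn o x).card ∧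
          (A.filter fun x => ω ∈ openConn o x).card ≤ j} ≤
      (prodBernoulli w).real {ω : BondConfig (Fin n) |
        (A.filter fun x => ω ∈ openConn a x).card ≤ j} := by
  refine measureReal_mono fun ω hω => ?_
  simp only [mem_setOf_eq] at hω ⊢
  obtain ⟨h1, h2⟩ := hω
  by_contra hlt
  push Not at hlt
  -- then `a`'s block is all of `A`
  have hle : (A.filter fun x => ω ∈ (openConn a x : Set (BondConfig (Fin n)))).card ≤ A.card :=
    Finset.card_filter_le _ _
  have heq : (A.filter fun x => ω ∈ (openConn a x : Set (BondConfig (Fin n)))) = A :=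
    Finset.eq_of_subset_of_card_le (Finset.filter_subset _ _) (by omega)
  have hall : ∀ x ∈ A, ω ∈ (openConn a x : Set (BondConfig (Fin n))) := fun x hx => by
    have : x ∈ A.filter fun x => ω ∈ (openConn a x : Set (BondConfig (Fin n))) := by rw [heq]; exact hx
    exact (Finset.mem_filter.1 this).2
  -- `o` meets some relay `b`, hence every relay (through `a`): `N = |A| > j`
  obtain ⟨b, hb⟩ := Finset.card_pos.1 h1
  obtain ⟨hbA, hob⟩ := Finset.mem_filter.1 hb
  have hob' : (openGraph ω).Reachable o b := hob
  have hfull : (A.filter fun x => ω ∈ (openConn o x : Set (BondConfig (Fin n)))) = A := by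
    refine Finset.Subset.antisymm (Finset.filter_subset _ _) fun x hx => Finset.mem_filter.2 ⟨hx, ?_⟩
    have hab : (openGraph ω).Reachable a b := hall b hbA
    have hax : (openGraph ω).Reachable a x := hall x hx
    exact hob'.trans (hab.symm.trans hax)
  rw [hfull] at h2
  omega

/-- **CIL for at most three relays, every level.**  For `A.card ≤ 3`, `A ≠ ∅`, `o ∉ A` and every `j` there
is a relay `a ∈ A` with `P(1 ≤ N ≤ j) ≤ P(|π(a)| ≤ j)` (level 0: empty event; level 1: lonely relay;
levels `≥ 2 ≥ |A| − 1`: extreme).  The registered signature of `stub_cumulativeIsolation` with the extra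
hypothesis `A.card ≤ 3`. -/
theorem cumulativeIsolation_card_le_three :
    ∀ (n : ℕ) (w : Sym2 (Fin n) → unitInterval) (A : Finset (Fin n)) (o : Fin n) (j : ℕ),
      A.card ≤ 3 → A.Nonempty → o ∉ A → ∃ a ∈ A,
        (Literature.Probability.LatticeModels.prodBernoulli w).real
            {ω : Literature.Probability.Percolation.BondConfig (Fin n) |
              1 ≤ (A.filter fun x => ω ∈ Literature.Probability.Percolation.openConn o x).card ∧
                (A.filter fun x => ω ∈ Literature.Probability.Percolation.openConn o x).card ≤ j} ≤
          (Literature.Probability.LatticeModels.prodBernoulli w).real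
            {ω : Literature.Probability.Percolation.BondConfig (Fin n) |
              (A.filter fun x => ω ∈ Literature.Probability.Percolation.openConn a x).card ≤ j} := by
  intro n w A o j hA3 hA _ho
  rcases Nat.lt_or_ge j 1 with hj0 | hj1
  · -- level 0: the event is empty
    obtain ⟨a, ha⟩ := hA
    refine ⟨a, ha, ?_⟩
    have hempty : {ω : BondConfig (Fin n) |
        1 ≤ (A.filter fun x => ω ∈ openConn o x).card ∧
          (A.filter fun x => ω ∈ openConn o x).card ≤ j} = ∅ := by
      ext ω; simp only [mem_setOf_eq, mem_empty_iff_false, iff_false]; omega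
    rw [hempty, measureReal_empty]
    exact measureReal_nonneg
  rcases Nat.lt_or_ge j 2 with hj2 | hj2
  · -- level 1
    have hj : j = 1 := by omega
    subst hj
    exact cumulativeIsolation_level_one w A o hA
  · -- levels ≥ 2 ≥ |A| - 1
    obtain ⟨a, ha⟩ := hA
    exact ⟨a, ha, cumulativeIsolation_level_ge w A o a j (by omega)⟩

end Summit.CriticalPhenomena.PercolationContinuityZ3.Theorems

end
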